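import Summits.CriticalPhenomena.PercolationContinuityZ3.Theorems.Transplant.SkelNeg1HoldsAllL
import Summits.CriticalPhenomena.PercolationContinuityZ3.Theorems.Transplant.Z3TallGensSign
import Summits.CriticalPhenomena.PercolationContinuityZ3.Theorems.Transplant.Z3TallGensExamples
import HarnessLib

/-!
# The single-type `{±1}` customers, UNCONDITIONAL — tall generators: `θ(v, p_c) = 0` at every vertex of every tall-generator lattice `Cay(ℤ³; S)`
# (`TallGens`: symmetric `S ⊇ {±e₀, ±e₁}` of unit range in the first two coordinates, arbitrary in the third), its images under `GL₃(ℤ)`, and the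
# diagonal-slant family `Cay(ℤ³; ±eᵢ, ±(e₀ + e₁ + m e₂))` — the p2 lineage's `…_of_negNode₁` corollaries (`Z3TallGensSign` / `Z3TallGensExamples`)
# applied to the closure `samePDropOfSkeletonNeg₁_holds` (`SkelNeg1HoldsAllL`, p329520)

builds on p205010 (kernel theorem, internal audit signed; external expert review pending).
Lane `prim-bschramm`, seat `prim-bschramm-p1` (gen 15); helper file (`--supports stmt-CriticalPhenomena-4575`); PROOFS ONLY (one-liners); the corollaries are the p2 lineage's
and are credited there.  NO HEADLINE FROM THIS SEAT (V112 (6): the lead's 'landed' lines, `X⋆` FIRST).  NOT CLAIMED: the multi-type node `SamePDropOfSkeletonNeg`, frames-only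
skeletons, rank-m, hcp, B–S Conj. 4 in general.
[cite: BenjaminiSchramm1996, Conj. 4] [cite: GrimmettPercolation1999, §12.1 p. 349]
-/

noncomputable section

namespace Summit.CriticalPhenomena.PercolationContinuityZ3.Theorems.Transplant

open MeasureTheory Literature.Probability.Percolation Literature.Probability.LatticeModels SimpleGraph
open scoped Classical

/-- **`θ(v, p_c) = 0` at every vertex of `Cay(ℤ³; S)` for EVERY tall generating set `S`** (`TallGens`). [cite: BenjaminiSchramm1996, Conj. 4] -/
theorem tallGens_criticalContinuity_holds (T : TallGens) (v : Site 3) : theta T.graph v (criticalProbIOf T.graph v) = 0 :=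
  T.criticalContinuity_of_negNode₁' samePDropOfSkeletonNeg₁_holds v

/-- `θ(0, p_c) = 0` on every tall-generator lattice (base-vertex form). [cite: BenjaminiSchramm1996, Conj. 4] -/
theorem tallGens_criticalContinuity_zero_holds (T : TallGens) : theta T.graph (0 : Site 3) (criticalProbIOf T.graph (0 : Site 3)) = 0 :=
  T.criticalContinuity_of_negNode₁ samePDropOfSkeletonNeg₁_holds

/-- **Images under a change of basis**: `θ(v, p_c) = 0` on `Cay(ℤ³; A(S))` for every tall `S` and every `A ∈ GL₃(ℤ)`. [cite: BenjaminiSchramm1996, Conj. 4] -/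
theorem tallGens_criticalContinuity_image_holds (T : TallGens) (A : Site 3 ≃+ Site 3) (v : Site 3) :
    theta (stepGraph 3 (T.S.image A)) v (criticalProbIOf (stepGraph 3 (T.S.image A)) v) = 0 :=
  T.criticalContinuity_image_of_negNode₁ samePDropOfSkeletonNeg₁_holds A v

/-- **The diagonal-slant family `Cay(ℤ³; ±eᵢ, ±(e₀ + e₁ + m e₂))`, every `m`, every vertex.** [cite: BenjaminiSchramm1996, Conj. 4] -/
theorem diagSlant_criticalContinuity_holds (m : ℤ) (v : Site 3) : theta (DiagSlant.graph m) v (criticalProbIOf (DiagSlant.graph m) v) = 0 :=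
  DiagSlant.criticalContinuity_of_negNode₁ samePDropOfSkeletonNeg₁_holds m v

end Summit.CriticalPhenomena.PercolationContinuityZ3.Theorems.Transplant

end
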